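import Literature.AlgebraicGeometry.ComplexMultiplication.SexticCMFieldPairFlip
import Literature.AlgebraicGeometry.Pohlmann1968.NondegenerateCMTypeDivisorClasses
import HarnessLib

/-!
# A sextic CM field admitting an octic reflex embedding has pair flips

COR-CM (cell `pub-hodgecm2`, binder seat `b16` gen 47, count-neutral claim CM34-COMPLETE, file F8; theorems only, no
definition, no named fact, no `sorry`).  The hypothesis of the reflex cell `CorCM/PairFlipSexticTimesReflexOcticHodge`
(seat b16 gen 45) is an embedding `ψ₀ : K_F → ℂ` of an octic CM field whose fixer in `Aut(ℂ)` is the stabiliser of a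
CM type `Φ_T` of the sextic field `K_T` — `ψ₀(K_F)` is the reflex field of `(K_T, Φ_T)` — TOGETHER WITH pair flips
on `K_T`.  Here the pair flips are DERIVED from the reflex embedding and the two degrees:

* §1 **`exists_pairFlip_of_reflex`** (abstract) — `G` transitive on `X` (`|X| = 6`) and on `Y` (`|Y| = 8`), `ρ` a
  commuting fixed-point-free involution on `X`, `y₀ ∈ Y` with `Fix(y₀) = Stab(Φ)` for a CM type `Φ ⊆ X`: then every
  conjugate pair of `X` is flipped by an element of `G` fixing the four other points.  PROOF: the image `R` of `G` in
  `Sym(X)` (coordinates `X ≃ Fin 6` conjugating `ρ` to `cc`) lies in `W(B₃)` (order `48`); the kernel `N` of `G → R`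
  fixes `X`, hence stabilises `Φ`, hence fixes `y₀`: `N ≤ Stab(y₀)` and `N ≤ Stab(x₀)`, so `8 = |Y|` and `6 = |X|`
  divide `[G : N] = |R|`, whence `|R| ∈ {24, 48}` and seat p2's `SexticB3.flips_mem` puts the three sign changes in `R`.
* §2 **`pairFlip_of_reflexEmbedding`** — for CM fields: `[K_T : ℚ] = 6`, `[K_F : ℚ] = 8` and a reflex embedding
  `ψ₀` give pair flips on `Hom(K_T, ℂ)`; equivalently (Dodson) the Galois closure of `K_T` has degree `24` or `48`.

## References

* [Dodson1984] B. Dodson, *The structure of Galois groups of CM-fields*, Trans. AMS 283 (1984), §1.1 (Reflex Degree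
  Theorem), §5.1.2.
* [Shimura1998] G. Shimura, *Abelian Varieties with Complex Multiplication and Modular Functions*, §8.3 Prop. 28.

Provenance: Literature home (namespace `Literature.AlgebraicGeometry.ComplexMultiplication.SexticOctic`) of the Summits-side `CorCM/ReflexOcticPairFlips` (cell `pub-hodgecm2`, COR-CM; all its imports are `Literature/`, Mathlib and the already re-homed `SexticCMFieldPairFlip`), which `Literature/` may not import; theorems only, no named fact, no definition. Nothing here bears on `HC_CM`. Lane `lit-hodgefound` (Layer A3: CM types, their Kubota ranks and Galois combinatorics), seat p20.
-/

noncomputable section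

namespace Literature.AlgebraicGeometry.ComplexMultiplication.SexticOctic

open Literature.AlgebraicGeometry.ComplexMultiplication.GenericCMField

open Equiv Literature.NumberTheory.ComplexMultiplication Literature.NumberTheory.ComplexMultiplication.SexticB3

/-! ## §1 The abstract flip -/

section Abstract

variable {G : Type*} [Group G] {X Y : Type*} [MulAction G X] [MulAction G Y] [Fintype X] [DecidableEq X]
  [Fintype Y]

omit [Fintype X] [DecidableEq X] in
/-- The permutation image in the coordinates `e` lies in `W(B₃)` as soon as `c` commutes with `G` ON `X` (no
centrality in `G` is needed). [cite: Dodson1984, §1.1 Imprimitivity Theorem] -/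
theorem range_toPerm6_le_W_of_comm {c : G} (e : X ≃ Fin 6) (hcomm : ∀ (g : G) (x : X), g • c • x = c • g • x)
    (hce : ∀ x, e (c • x) = cc (e x)) : (toPerm6 (G := G) e).range ≤ W := by
  rintro _ ⟨g, rfl⟩
  rw [mem_W, ← toPerm6_eq_cc hce, ← map_mul, ← map_mul]
  refine Equiv.ext fun i => ?_
  simp only [toPerm6_apply, mul_smul, hcomm]

/-- **A reflex point for a sextic slot inside an octic slot forces pair flips.**  `G` transitive on `X` (`|X| = 6`) and
on `Y` (`|Y| = 8`), `ρ` a commuting fixed-point-free involution on `X` (a CM type `Φ` for `ρ`), `y₀ ∈ Y` with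
`Fix(y₀) = Stab(Φ)`: every pair `{x₀, ρx₀}` is exchanged by some `g ∈ G` fixing the other four points — the image of
`G` in `Sym(X)` has order divisible by `6` and by `8` inside `W(B₃)` of order `48`.
[cite: Dodson1984, §5.1.2 Theorem] [cite: Shimura1998, §8.3 Prop. 28] -/
theorem exists_pairFlip_of_reflex [MulAction.IsPretransitive G X] [MulAction.IsPretransitive G Y] {ρ : G}
    {Φ : Set X} (hΦ : IsCMTypeWith ρ Φ) (hX : Fintype.card X = 6) (hY : Fintype.card Y = 8) {y₀ : Y}
    (hst : ∀ g : G, g • y₀ = y₀ ↔ ∀ x : X, g • x ∈ Φ ↔ x ∈ Φ) (x₀ : X) :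
    ∃ g : G, g • x₀ = ρ • x₀ ∧ ∀ x : X, x ≠ x₀ → x ≠ ρ • x₀ → g • x = x := by
  classical
  obtain ⟨e, he0, hce⟩ := exists_equiv_cc hX (MulAction.toPerm ρ)
    (fun x => by simpa [MulAction.toPerm_apply] using hΦ.invol x) (fun x => hΦ.rho_smul_ne x) x₀
  replace hce : ∀ x, e (ρ • x) = cc (e x) := fun x => by simpa [MulAction.toPerm_apply] using hce x
  set f : G →* Perm (Fin 6) := toPerm6 e with hf
  have hW : f.range ≤ W := range_toPerm6_le_W_of_comm e hΦ.comm hce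
  have hcc : cc ∈ f.range := ⟨ρ, toPerm6_eq_cc hce⟩
  -- the kernel fixes `X`, hence stabilises `Φ`, hence fixes `y₀`
  have hker : ∀ g : G, g ∈ f.ker → ∀ x : X, g • x = x := by
    intro g hg x
    have h := congrArg (fun p : Perm (Fin 6) => p (e x)) (MonoidHom.mem_ker.1 hg)
    simp only [hf, toPerm6_apply, Equiv.symm_apply_apply, Perm.coe_one, id_eq] at h
    exact e.injective h
  have hkx : f.ker ≤ MulAction.stabilizer G x₀ := fun g hg => hker g hg x₀
  have hky : f.ker ≤ MulAction.stabilizer G y₀ := fun g hg =>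
    (hst g).2 fun x => by rw [hker g hg x]
  -- `6 ∣ |R|`, `8 ∣ |R|`, `|R| ∣ 48`
  have h6 : 6 ∣ Nat.card f.range := by
    rw [← Subgroup.index_ker]
    have h := Subgroup.index_dvd_of_le hkx
    rwa [MulAction.index_stabilizer_of_transitive, Nat.card_eq_fintype_card, hX] at h
  have h8 : 8 ∣ Nat.card f.range := by
    rw [← Subgroup.index_ker]
    have h := Subgroup.index_dvd_of_le hky
    rwa [MulAction.index_stabilizer_of_transitive, Nat.card_eq_fintype_card, hY] at h
  have h48 : Nat.card f.range ∣ 48 := by rw [← card_W]; exact Subgroup.card_dvd_of_le hW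
  have hcard : Nat.card f.range = 24 ∨ Nat.card f.range = 48 := by
    have h24 : 24 ∣ Nat.card f.range := by
      have h := Nat.lcm_dvd h8 h6
      have hl : Nat.lcm 8 6 = 24 := by norm_num
      rwa [hl] at h
    obtain ⟨k, hk⟩ := h24
    obtain ⟨m, hm⟩ := h48
    rw [hk] at hm ⊢
    have hkm : k * m = 2 := by
      apply Nat.eq_of_mul_eq_mul_left (show 0 < 24 by norm_num)
      rw [← mul_assoc, ← hm]
    have hk2 : k ∣ 2 := ⟨m, hkm.symm⟩
    rcases (Nat.dvd_prime Nat.prime_two).1 hk2 with rfl | rfl <;> simp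
  -- the sign change at place `0` lies in the image
  obtain ⟨⟨g, hg⟩, -, -⟩ := flips_mem f.range hW hcc hcard
  have hgy : ∀ x : X, e (g • x) = swap (0 : Fin 6) 3 (e x) := fun x => by
    have := congrArg (fun p : Perm (Fin 6) => p (e x)) hg
    simpa only [hf, toPerm6_apply, Equiv.symm_apply_apply, f0] using this
  have hc0 : e (ρ • x₀) = 3 := by rw [hce, he0, cc_apply]; decide
  refine ⟨g, e.injective ?_, fun x hx hxc => e.injective ?_⟩
  · rw [hgy, he0, hc0, swap_apply_left]
  · rw [hgy]
    exact swap_apply_of_ne_of_ne (fun h => hx (e.injective (h.trans he0.symm)))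
      (fun h => hxc (e.injective (h.trans hc0.symm)))

end Abstract

/-! ## §2 CM fields -/

section Fields

open NumberField
open Literature.AlgebraicGeometry.Motives (CMType)
open Literature.AlgebraicGeometry.Pohlmann1968 (isCMTypeWith_conj isPretransitive_ringEquiv_complex)

variable {K K' : Type} [Field K] [NumberField K] [IsCMField K] [Field K'] [NumberField K']

/-- **A sextic CM field with an octic reflex embedding has pair flips.**  If `[K : ℚ] = 6`, `[K' : ℚ] = 8` and
`ψ₀ : K' → ℂ` has fixer `Stab(Φ)` in `Aut(ℂ)` for a CM type `Φ` of `K` (`ψ₀(K')` is the reflex field of `(K, Φ)`), then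
every conjugate pair of complex embeddings of `K` is exchanged by an automorphism of `ℂ` fixing the other four — so
`K` is a pair-flip sextic field (Galois closure of degree `24` or `48`) and the reflex dichotomy of
`CorCM/PairFlipSexticTimesReflexOcticHodge` applies. [cite: Dodson1984, §1.1 and §5.1.2]
[cite: Shimura1998, §8.3 Prop. 28] -/
theorem pairFlip_of_reflexEmbedding (h6 : Module.finrank ℚ K = 6) (h8 : Module.finrank ℚ K' = 8) (Φ : CMType K)
    {ψ₀ : K' →+* ℂ} (hψ₀ : ∀ σ : ℂ ≃+* ℂ, σ • ψ₀ = ψ₀ ↔ ∀ x : K →+* ℂ, σ • x ∈ Φ.1 ↔ x ∈ Φ.1) :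
    ∀ s : K →+* ℂ, ∃ σ : ℂ ≃+* ℂ, σ • s = (starRingAut : ℂ ≃+* ℂ) • s ∧
      ∀ t : K →+* ℂ, t ≠ s → t ≠ (starRingAut : ℂ ≃+* ℂ) • s → σ • t = t := by
  classical
  haveI := isPretransitive_ringEquiv_complex (K := K)
  haveI := isPretransitive_ringEquiv_complex (K := K')
  have hX : Fintype.card (K →+* ℂ) = 6 := by rw [NumberField.Embeddings.card, h6]
  have hY : Fintype.card (K' →+* ℂ) = 8 := by rw [NumberField.Embeddings.card, h8]
  intro s
  exact exists_pairFlip_of_reflex (isCMTypeWith_conj Φ) hX hY hψ₀ s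

end Fields

end Literature.AlgebraicGeometry.ComplexMultiplication.SexticOctic

end
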